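import Summits.CriticalPhenomena.Ising3DConformalLimit.Theses.UnitLightCone
import Summits.CriticalPhenomena.Ising3DConformalLimit.Theorems.HyperoctahedralRPTwoPointLimitIsotropicHolds
import HarnessLib

/-!
# Disproof of `LightConeRoundness` (crux stmt-CriticalPhenomena-17169) — findings

Work file of the crux disprover (cdisprove, cycle 1, 2026-08-17).

**STATUS.** The crux is CLOSED · proved (2026-08-17T12:33Z, commit 53947f98) by
`Summit.CriticalPhenomena.Ising3DConformalLimit.Theorems.UnitLightConeLightConeRoundness.lightConeRoundness_proof`
(= `HyperoctahedralRPTwoPoint.kernel_rotation_invariant`, route HyperoctahedralRP item stmt-1984, under a SUBSET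
of the hypotheses).  Consequently NO refutation of the crux exists; this file records the hypothesis analysis.

Hypotheses of the crux (`lightConeRoundness_iff`):
H1 `ρ > 0` on `(0,1]`; H2 `HasPointwiseScalingLimit (criticalCorr 3) ρ S`; H3 normalisation `S = 0` off
`NonCoincident`; H4 `IsNondegenerateTwoPoint S`; H5 `IsTranslationInvariant S`; H6 `IsScaleCovariant Δ S`;
H7 unit-cone Källén–Lehmann representation of `K x := S 2 (0,x)` in the axis frame `e₃` (`AxisConeKL K`);
H8 the same in the face-diagonal frame `(e₁+e₂)/√2` (`DiagConeKL K`).  Conclusion: `K (R x) = K x` for every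
linear isometry `R`.

Findings (all kernel-checked unless marked PAPER; coordinates: §§ 0–2 prose uses the route's 1-based
`x₁,x₂,x₃ / e₁,e₂,e₃`, § 3 prose uses Lean's 0-based indices `x 0, x 1, x 2 / e₀,e₁,e₂` — the route's axis frame
`e₃` is Lean coordinate `2`, its diagonal frame `(e₁+e₂)/√2` is `(e₀+e₁)/√2` in § 3):
* § 1 `conclusion_without_normalisation_and_KL` — H3, H7, H8 are DECORATION: H1 ∧ H2 ∧ H4 ∧ H5 ∧ H6 already give
  the conclusion (tree theorem `kernel_rotation_invariant`).  The route's advertised light-cone input (H7, H8 =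
  crux `UnitSpeedTwoPoint`, stmt-17167, open-problem) is not needed for clause (ii) at `n = 2`.
* § 2 `lightConeRoundness_false_without_isingLimit` — H2 (with H1) is LOAD-BEARING even in the presence of the
  two unit-cone representations: the model-blind statement `LightConeRoundnessWithoutIsingLimit`
  (H3 ∧ H4 ∧ H5 ∧ H6 ∧ H7 ∧ H8 ⇒ roundness) is FALSE.  Witness (`blindFamily`): `Δ = 0`, two-point kernel
  `blindKernel` equal to `1` off the BLIND LINE `L = {x₃ = 0} ∩ {x₁ + x₂ = 0}` and to `2` on `L ∖ {0}`
  (`0` at the origin), all other `S n = 0`; both KL measures are the Dirac mass at `(k, ω) = (0, 0)` (cone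
  condition `μ {ω < ‖k‖} = 0` holds since `0 < ‖0‖` is false).  Neither frame sees `L` (`t = x₃ ≠ 0`, resp.
  `t = (x₁+x₂)/√2 ≠ 0`), `Δ = 0` is allowed by the crux's binder `Δ : ℝ`, and the coordinate swap `x₂ ↔ x₃`
  moves `(1,-1,0) ∈ L` off `L`.  What the Ising hypothesis H2 supplies and the witness lacks: the window
  `1/2 ≤ Δ ≤ 1`, continuity off `0` and the nine lattice mirror symmetries (tree theorem
  `twoPointKernelOfLimit_proof`).  Any proof of the crux from H7/H8 (line `birth`) must use them.
* § 3 `lightConeRoundness_false_without_mirrors_of_roundKL` — WHICH part of the Ising input is load-bearing for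
  the light-cone mechanism: the lattice MIRROR symmetries.  `LightConeRoundnessWithoutMirrors` (crux minus H1, H2,
  plus the window `1/2 ≤ Δ ≤ 1` and continuity off `0`; positivity = H4, homogeneity = H6; both cones H7, H8 kept)
  is FALSE conditionally on `RoundKernelAxisConeKL Δ₀` for one `Δ₀ ∈ [1/2,1]` (the classical cone-supported KL
  representation of the ROUND kernel `(a²+b²+t²)^(-Δ₀)`, a 2-D Fourier–Bessel identity, TRUE, not in Mathlib —
  the only non-formalised input).  Witness: the ELLIPSOID family `Q(z-y)^(-Δ₀)`,
  `Q = 2x₀² + 2x₀x₁ + 2x₁² + 3x₂² = 3x_d² + x_{d'}² + 3x₂²` (`d = (e₀+e₁)/√2`): in each of the two frames the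
  transverse form is `≼` the time coefficient, so the round measure pushed forward under a momentum CONTRACTION
  (`axisMap`, `diagMap`, `‖k'‖ ≤ ‖k‖`, cone preserved: `cone_of_map`) and scaled by `3^(-Δ₀)` represents
  `Q^(-Δ₀)`; and `Q(e₀)^(-Δ₀) = 2^(-Δ₀) ≠ 3^(-Δ₀) = Q(e₂)^(-Δ₀)`.  The ellipsoid keeps `x₀ ↔ x₁`, `x₂ ↦ -x₂`,
  `(x₀,x₁) ↦ -(x₀,x₁)` and lacks exactly the quarter turn about `e₂` used by the Paley–Wiener step of line `birth`.
* § 4 (landed, p162666: `Theorems/LightConeRoundness/Negative/RoundKernelKL.lean`, sorry-free, std axioms): `roundKernelAxisConeKL_half : RoundKernelAxisConeKL (1/2)` — the classical input of § 3 PROVED at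
  `Δ₀ = 1/2` (Bessel-free: Fubini over the massless shell `(θ,κ) ↦ (κ(cos θ, sin θ), κ)` with density
  `(2π)⁻¹ dθ dκ`, the Laplace–cosine integral `∫₀^∞ e^{-κτ} cos(κ s) dκ = τ/(τ²+s²)`, and the angular integral
  `∫₀^{2π} τ dθ/(τ² + (a cos θ + b sin θ)²) = 2π/√(a²+b²+τ²)` by the explicit global antiderivative
  `E⁻¹(θ - arctan(c u(θ)/(1 + c v(θ))))`, `c = (E-τ)/(E+τ)`), hence
  `lightConeRoundness_false_without_mirrors : ¬ LightConeRoundnessWithoutMirrors` UNCONDITIONALLY, and the KL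
  hypotheses of the crux / of support stmt-17170 are certified NON-VACUOUS by the genuine kernel `1/|x|`
  (verbatim hypothesis list of `TwoPointLightConeRigidity` at `Δ = 1/2`, `K = 1/‖x‖`:
  `twoPointLightConeRigidity_hypotheses_satisfiable`, file `Negative/RigidityHypothesesSatisfiable.lean`, p163032).
  Landed negative-side files of this cycle: `Negative/FalseWithoutIsingLimit.lean` (p161369),
  `Negative/FalseWithoutMirrors.lean` (p161838), `Negative/RoundKernelKL.lean` (p162666).
* PAPER (not formalised):
  - for the model-blind support `TwoPointLightConeRigidity` (stmt-17170): the tube of holomorphy of the frame-`e₁`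
    representation is `{|Re z₁| > ‖(Im z₂, Im z₃)‖}`; on the complexified latitude circle
    `(s cos ψ, s sin ψ, c)` this is `cos (Re ψ) ≠ 0` at EVERY height `c` and depth `Im ψ` (the planner's bound
    `|c| < 0.91` is pessimistic), so frames `e₁, e₂` alone make `ψ ↦ K` entire of exponential type `2Δ`, and the
    quarter turn kills all modes for `Δ < 2`.  Hence the diagonal-frame hypothesis, `ContinuousOn K {0}ᶜ`
    (automatic from the representations + mirrors), positivity of `K` and `0 < Δ` (at `Δ = 0` the mirrors force
    `K` constant off `0`; `Δ < 0` contradicts `t ↦ K(t e₃)` non-increasing) are NOT load-bearing there.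
    The unit-cone SUPPORT: a KL representation with ANY support already gives reflection positivity w.r.t. the
    frame's mirror (`Σ c_a c_b K(p_a - θp_b) = ∫ |Σ_a c_a e^{-ω t_a} e^{ik·w_a}|² dμ ≥ 0`), transported by `O_h` to
    all nine mirrors; inside the window `1/2 ≤ Δ ≤ 1` isotropy then follows ANYWAY from the tree theorem
    `HRP2Rigidity_of` (nine-mirror RP rigidity) — so in the window no spectral-support hypothesis is load-bearing
    and the light-cone line is a second proof, not a stronger one; the cone's extra reach is `Δ ∈ (0,1/2) ∪ (1,2)`
    and the AXIS-FRAME-ONLY variant, for which the cone IS load-bearing: the `O_h`-symmetrisation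
    `Σ_g |A g x|^{-2Δ}` of a linear distortion is RP in the three axis frames (spacelike spectral weight),
    `O_h`-invariant, homogeneous, anisotropic — hence, by `HRP2Rigidity_of`, necessarily NOT RP in the diagonal
    frames.
    Tightness of `Δ < 2` is open: the cubic-harmonic perturbation `|x|^{-2Δ}(1 + ε Y₄)` violates spectral
    positivity in every frame for `Δ ≤ 5/2` (edge singularity `(ω²-k²)^{Δ-7/2}` not a measure) and in the
    diagonal frame for every `Δ` (the edge coefficient `-2q_u⁴ - 2q_u²p₃² + (3/2)p₃⁴` changes sign).
-/

namespace Summit.CriticalPhenomena.Ising3DConformalLimit.Cruxes.LightConeRoundness.Disproof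

open Literature.Probability.LatticeModels MeasureTheory
open Summit.CriticalPhenomena.Ising3DConformalLimit.Theses.UnitLightCone

/-! ## § 0  The crux, restated with named Källén–Lehmann predicates -/

/-- H7: unit-cone Källén–Lehmann representation of a kernel `K` on `ℝ³` in the axis frame `e₃`
(time `t = x₃`, transverse `(a,b) = (x₁,x₂)`), verbatim sub-formula of the crux. -/
def AxisConeKL (K : EuclideanSpace ℝ (Fin 3) → ℝ) : Prop :=
  ∃ μ : Measure (EuclideanSpace ℝ (Fin 2) × ℝ), μ {p : EuclideanSpace ℝ (Fin 2) × ℝ | p.2 < ‖p.1‖} = 0 ∧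
    (∀ t a b : ℝ, t ≠ 0 → K (EuclideanSpace.single 0 a + EuclideanSpace.single 1 b + EuclideanSpace.single 2 t) =
      ∫ p, Real.cos (p.1 0 * a + p.1 1 * b) * Real.exp (-(p.2 * |t|)) ∂μ)

/-- H8: unit-cone Källén–Lehmann representation of `K` in the face-diagonal frame `(e₁+e₂)/√2`
(time `t`, transverse `(u,v)` along `(e₁-e₂)/√2` and `e₃`), verbatim sub-formula of the crux. -/
def DiagConeKL (K : EuclideanSpace ℝ (Fin 3) → ℝ) : Prop :=
  ∃ μ : Measure (EuclideanSpace ℝ (Fin 2) × ℝ), μ {p : EuclideanSpace ℝ (Fin 2) × ℝ | p.2 < ‖p.1‖} = 0 ∧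
    (∀ t u v : ℝ, t ≠ 0 → K (EuclideanSpace.single 0 ((t + u) / Real.sqrt 2) +
        EuclideanSpace.single 1 ((t - u) / Real.sqrt 2) + EuclideanSpace.single 2 v) =
      ∫ p, Real.cos (p.1 0 * u + p.1 1 * v) * Real.exp (-(p.2 * |t|)) ∂μ)

/-- The crux, hypothesis by hypothesis (H1 … H8 ⇒ two-point `O(3)` invariance). -/
theorem lightConeRoundness_iff :
    LightConeRoundness ↔
      ∀ (ρ : ℝ → ℝ) (Δ : ℝ) (S : CorrFamily 3), (∀ δ ∈ Set.Ioc (0:ℝ) 1, 0 < ρ δ) →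
        HasPointwiseScalingLimit (criticalCorr 3) ρ S → (∀ n z, z ∉ NonCoincident 3 n → S n z = 0) →
        IsNondegenerateTwoPoint S → IsTranslationInvariant S → IsScaleCovariant Δ S →
        AxisConeKL (fun x => S 2 ![0, x]) → DiagConeKL (fun x => S 2 ![0, x]) →
        ∀ (R : EuclideanSpace ℝ (Fin 3) ≃ₗᵢ[ℝ] EuclideanSpace ℝ (Fin 3)) (x : EuclideanSpace ℝ (Fin 3)),
          S 2 ![0, R x] = S 2 ![0, x] :=
  Iff.rfl

/-! ## § 1  Decoration: H3, H7, H8 are not needed (the crux is a tree theorem without them) -/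

/-- H3 (normalisation), H7 and H8 (the two unit-cone representations) are DECORATION: the conclusion of the
crux follows from H1, H2, H4, H5, H6 alone, by the landed theorem `kernel_rotation_invariant`
(route HyperoctahedralRP, item stmt-CriticalPhenomena-1984). -/
theorem conclusion_without_normalisation_and_KL (ρ : ℝ → ℝ) (Δ : ℝ) (S : CorrFamily 3)
    (hρ : ∀ δ ∈ Set.Ioc (0:ℝ) 1, 0 < ρ δ) (hlim : HasPointwiseScalingLimit (criticalCorr 3) ρ S)
    (hnd : IsNondegenerateTwoPoint S) (htr : IsTranslationInvariant S) (hsc : IsScaleCovariant Δ S)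
    (R : EuclideanSpace ℝ (Fin 3) ≃ₗᵢ[ℝ] EuclideanSpace ℝ (Fin 3)) (x : EuclideanSpace ℝ (Fin 3)) :
    S 2 ![0, R x] = S 2 ![0, x] :=
  HyperoctahedralRPTwoPoint.kernel_rotation_invariant hρ hlim hnd htr hsc R x

/-! ## § 2  Load-bearing: the Ising hypothesis H2 (any proof from H7/H8 must use what H2 supplies) -/

/-- The crux with the Ising-limit hypotheses H1, H2 DROPPED: the model-blind statement "a normalised,
non-degenerate, translation-invariant, scale-covariant (some `Δ : ℝ`) family whose two-point kernel has
unit-cone Källén–Lehmann representations in the frames `e₃` and `(e₁+e₂)/√2` has a round two-point kernel".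
FALSE: `lightConeRoundness_false_without_isingLimit`. -/
def LightConeRoundnessWithoutIsingLimit : Prop :=
  ∀ (Δ : ℝ) (S : CorrFamily 3), (∀ n z, z ∉ NonCoincident 3 n → S n z = 0) →
    IsNondegenerateTwoPoint S → IsTranslationInvariant S → IsScaleCovariant Δ S →
    AxisConeKL (fun x => S 2 ![0, x]) → DiagConeKL (fun x => S 2 ![0, x]) →
    ∀ (R : EuclideanSpace ℝ (Fin 3) ≃ₗᵢ[ℝ] EuclideanSpace ℝ (Fin 3)) (x : EuclideanSpace ℝ (Fin 3)),
      S 2 ![0, R x] = S 2 ![0, x]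

/-- The Ising-free version implies the crux (it is the crux with two hypotheses deleted). -/
theorem lightConeRoundness_of_withoutIsingLimit (h : LightConeRoundnessWithoutIsingLimit) :
    LightConeRoundness :=
  fun _ρ Δ S _hρ _hlim hnorm hnd htr hsc hax hdg => h Δ S hnorm hnd htr hsc hax hdg

/-- The blind-line kernel: `0` at the origin, `2` on the line `{x₃ = 0, x₁ + x₂ = 0}` minus the origin,
`1` elsewhere.  Homogeneous of degree `0`, not round. -/
noncomputable def blindKernel (x : EuclideanSpace ℝ (Fin 3)) : ℝ :=
  if x = 0 then 0 else if x 2 = 0 ∧ x 0 + x 1 = 0 then 2 else 1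

/-- The witness family: `S 2 (y, z) = blindKernel (z - y)`, all other `S n = 0`. -/
noncomputable def blindFamily : CorrFamily 3
  | 2 => fun z => blindKernel (z 1 - z 0)
  | _ => fun _ => 0

/-- The two-point entry of the witness family. -/
@[simp] theorem blindFamily_two (z : Fin 2 → EuclideanSpace ℝ (Fin 3)) :
    blindFamily 2 z = blindKernel (z 1 - z 0) := rfl

/-- Every entry of the witness family other than the two-point one vanishes. -/
theorem blindFamily_ne_two {n : ℕ} (hn : n ≠ 2) (z : Fin n → EuclideanSpace ℝ (Fin 3)) :
    blindFamily n z = 0 := by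
  match n, hn with
  | 0, _ => rfl
  | 1, _ => rfl
  | 2, h => exact absurd rfl h
  | _ + 3, _ => rfl

/-- The blind-line kernel vanishes at the origin. -/
theorem blindKernel_zero : blindKernel 0 = 0 := by simp [blindKernel]

/-- The blind-line kernel is positive off the origin. -/
theorem blindKernel_pos {x : EuclideanSpace ℝ (Fin 3)} (hx : x ≠ 0) : 0 < blindKernel x := by
  unfold blindKernel
  rw [if_neg hx]
  split_ifs <;> norm_num

/-- Off the plane `{x₃ = 0}` (the region seen by the axis frame `e₃`) the kernel equals `1`. -/
theorem blindKernel_of_apply_two_ne {x : EuclideanSpace ℝ (Fin 3)} (hx : x 2 ≠ 0) : blindKernel x = 1 := by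
  have hx0 : x ≠ 0 := fun h => hx (by simp [h])
  unfold blindKernel
  rw [if_neg hx0, if_neg fun h => hx h.1]

/-- Off the plane `{x₁ + x₂ = 0}` (the region seen by the diagonal frame) the kernel equals `1`. -/
theorem blindKernel_of_sum_ne {x : EuclideanSpace ℝ (Fin 3)} (hx : x 0 + x 1 ≠ 0) : blindKernel x = 1 := by
  have hx0 : x ≠ 0 := fun h => hx (by simp [h])
  unfold blindKernel
  rw [if_neg hx0, if_neg fun h => hx h.2]

/-- The blind-line kernel is homogeneous of degree `0`. -/
theorem blindKernel_smul {c : ℝ} (hc : c ≠ 0) (x : EuclideanSpace ℝ (Fin 3)) :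
    blindKernel (c • x) = blindKernel x := by
  have h0 : c • x = 0 ↔ x = 0 := smul_eq_zero_iff_right hc
  have h2 : (c • x) 2 = 0 ↔ x 2 = 0 := by simp [hc]
  have h01 : (c • x) 0 + (c • x) 1 = 0 ↔ x 0 + x 1 = 0 := by
    simp only [PiLp.smul_apply, smul_eq_mul, ← mul_add, mul_eq_zero, hc, false_or]
  unfold blindKernel
  simp only [h0, h2, h01]

/-- H3 for the witness: it vanishes off the non-coincident configurations. -/
theorem blindFamily_normalised : ∀ n z, z ∉ NonCoincident 3 n → blindFamily n z = 0 := by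
  intro n z hz
  by_cases hn : n = 2
  · subst hn
    rw [blindFamily_two]
    have h10 : z 1 - z 0 = 0 := by
      rw [mem_nonCoincident, Function.Injective] at hz
      push Not at hz
      obtain ⟨i, j, hij, hne⟩ := hz
      fin_cases i <;> fin_cases j
      · exact absurd rfl hne
      · simpa [sub_eq_zero] using hij.symm
      · simpa [sub_eq_zero] using hij
      · exact absurd rfl hne
    rw [h10, blindKernel_zero]
  · exact blindFamily_ne_two hn z

/-- H4 for the witness: the two-point function is positive off the diagonal. -/
theorem blindFamily_nondegenerate : IsNondegenerateTwoPoint blindFamily := by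
  intro z hz
  rw [mem_nonCoincident] at hz
  rw [blindFamily_two]
  refine blindKernel_pos fun h => ?_
  have h10 : z 1 = z 0 := sub_eq_zero.mp h
  exact absurd (hz h10) (by decide)

/-- H5 for the witness: translation invariance. -/
theorem blindFamily_translationInvariant : IsTranslationInvariant blindFamily := by
  intro n v z
  by_cases hn : n = 2
  · subst hn
    simp only [blindFamily_two, add_sub_add_right_eq_sub]
  · simp [blindFamily_ne_two hn]

/-- H6 for the witness, with `Δ = 0`. -/
theorem blindFamily_scaleCovariant : IsScaleCovariant 0 blindFamily := by
  intro n c hc z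
  have h1 : c ^ (-(n : ℝ) * 0) = 1 := by rw [mul_zero, Real.rpow_zero]
  rw [h1, one_mul]
  by_cases hn : n = 2
  · subst hn
    simp only [blindFamily_two]
    rw [← smul_sub, blindKernel_smul hc.ne']
  · simp [blindFamily_ne_two hn]

/-- The Dirac mass at `(k, ω) = (0, 0)`: the common Källén–Lehmann measure of the witness in both frames. -/
noncomputable def diracZero : Measure (EuclideanSpace ℝ (Fin 2) × ℝ) :=
  Measure.dirac ((0 : EuclideanSpace ℝ (Fin 2)), (0 : ℝ))

/-- The Dirac mass at `(0,0)` gives no weight to the spacelike region `{ω < ‖k‖}`. -/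
theorem diracZero_cone : diracZero {p : EuclideanSpace ℝ (Fin 2) × ℝ | p.2 < ‖p.1‖} = 0 := by
  rw [diracZero, Measure.dirac_apply]
  exact Set.indicator_of_notMem (by simp) _

/-- The Källén–Lehmann integral against the Dirac mass at `(0,0)` is identically `1`. -/
theorem integral_diracZero (a b t : ℝ) :
    ∫ p, Real.cos (p.1 0 * a + p.1 1 * b) * Real.exp (-(p.2 * |t|)) ∂diracZero = 1 := by
  rw [diracZero, integral_dirac]
  simp

/-- H7 for the witness: unit-cone Källén–Lehmann representation in the axis frame `e₃`. -/
theorem blindFamily_axisConeKL : AxisConeKL (fun x => blindFamily 2 ![0, x]) := by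
  refine ⟨diracZero, diracZero_cone, fun t a b ht => ?_⟩
  rw [integral_diracZero]
  simp only [blindFamily_two, Matrix.cons_val_one, Matrix.cons_val_zero, sub_zero]
  apply blindKernel_of_apply_two_ne
  simpa using ht

/-- H8 for the witness: unit-cone Källén–Lehmann representation in the diagonal frame `(e₁+e₂)/√2`. -/
theorem blindFamily_diagConeKL : DiagConeKL (fun x => blindFamily 2 ![0, x]) := by
  refine ⟨diracZero, diracZero_cone, fun t u v ht => ?_⟩
  rw [integral_diracZero]
  simp only [blindFamily_two, Matrix.cons_val_one, Matrix.cons_val_zero, sub_zero]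
  apply blindKernel_of_sum_ne
  have h2 : Real.sqrt 2 ≠ 0 := Real.sqrt_ne_zero'.mpr two_pos
  have hsum : (t + u) / Real.sqrt 2 + (t - u) / Real.sqrt 2 = 2 * t / Real.sqrt 2 := by ring
  simp only [PiLp.add_apply, PiLp.single_apply]
  simp only [Fin.isValue, ↓reduceIte, Fin.zero_eq_one_iff, OfNat.ofNat_ne_one, Fin.reduceEq, add_zero,
    Fin.one_eq_zero_iff, zero_add]
  rw [hsum]
  exact div_ne_zero (mul_ne_zero two_ne_zero ht) h2

/-- **H2 is load-bearing.**  The crux with the Ising scaling-limit hypothesis dropped is false: the blind-line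
family (`Δ = 0`) satisfies H3–H8 and its two-point kernel is not invariant under the swap `x₂ ↔ x₃`. -/
theorem lightConeRoundness_false_without_isingLimit : ¬ LightConeRoundnessWithoutIsingLimit := by
  intro h
  have key := h 0 blindFamily blindFamily_normalised blindFamily_nondegenerate blindFamily_translationInvariant
    blindFamily_scaleCovariant blindFamily_axisConeKL blindFamily_diagConeKL
    (LinearIsometryEquiv.piLpCongrLeft 2 ℝ ℝ (Equiv.swap (1 : Fin 3) 2))
    (EuclideanSpace.single 0 1 - EuclideanSpace.single 1 1)
  simp only [blindFamily_two, Matrix.cons_val_one, Matrix.cons_val_zero, sub_zero, map_sub,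
    LinearIsometryEquiv.piLpCongrLeft_single] at key
  have hL : blindKernel (EuclideanSpace.single 0 1 - EuclideanSpace.single 1 1) = 2 := by
    have hne : (EuclideanSpace.single 0 1 - EuclideanSpace.single 1 1 : EuclideanSpace ℝ (Fin 3)) ≠ 0 := by
      intro h0
      have := congrArg (fun x : EuclideanSpace ℝ (Fin 3) => x 0) h0
      simp at this
    unfold blindKernel
    rw [if_neg hne, if_pos]
    simp
  have hR : blindKernel (EuclideanSpace.single ((Equiv.swap (1 : Fin 3) 2) 0) 1 -
      EuclideanSpace.single ((Equiv.swap (1 : Fin 3) 2) 1) 1) = 1 := by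
    apply blindKernel_of_apply_two_ne
    simp [Equiv.swap_apply_of_ne_of_ne]
  rw [hL, hR] at key
  norm_num at key


/-! ## § 3  Load-bearing inside H2: the lattice MIRROR symmetries (ellipsoid witness at physical `Δ`) -/

/-- Classical input (TRUE; not in Mathlib, not formalised here): the ROUND kernel `(a² + b² + t²)^(-Δ)` has a
unit-cone Källén–Lehmann representation in the axis frame.  For `Δ = 1/2` this is the Poisson / Fourier–Bessel
identity `∫_{ℝ²} cos(k·w) e^{-|k| t} d²k / (2π|k|) = (|w|² + t²)^{-1/2}` (spectral measure `d²k/(2π|k|) ⊗ δ_{ω=|k|}`,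
carried by the cone `ω = |k|`); for `Δ > 1/2` superpose the massive kernels `e^{-m|x|}/|x|`, weight `m^{2Δ-2} dm`
(`ω = √(k²+m²) ≥ |k|`).  Glimm–Jaffe 1987 §6.2 (free covariance); Stein–Weiss 1971 Ch. I Thm 1.14 (Poisson kernel). -/
def RoundKernelAxisConeKL (Δ : ℝ) : Prop :=
  ∃ μ : Measure (EuclideanSpace ℝ (Fin 2) × ℝ), μ {p : EuclideanSpace ℝ (Fin 2) × ℝ | p.2 < ‖p.1‖} = 0 ∧
    (∀ t a b : ℝ, t ≠ 0 → (a ^ 2 + b ^ 2 + t ^ 2) ^ (-Δ) =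
      ∫ p, Real.cos (p.1 0 * a + p.1 1 * b) * Real.exp (-(p.2 * |t|)) ∂μ)

/-- The crux with H1, H2 deleted and, of what H2 supplies through the tree theorem `twoPointKernelOfLimit_proof`,
everything EXCEPT the nine lattice mirror symmetries put back: the window `1/2 ≤ Δ ≤ 1` and continuity of the
kernel off `0` (positivity is H4, homogeneity is H6).  FALSE modulo `RoundKernelAxisConeKL`:
`lightConeRoundness_false_without_mirrors_of_roundKL`. -/
def LightConeRoundnessWithoutMirrors : Prop :=
  ∀ (Δ : ℝ) (S : CorrFamily 3), 1 / 2 ≤ Δ → Δ ≤ 1 → (∀ n z, z ∉ NonCoincident 3 n → S n z = 0) →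
    IsNondegenerateTwoPoint S → IsTranslationInvariant S → IsScaleCovariant Δ S →
    ContinuousOn (fun x : EuclideanSpace ℝ (Fin 3) => S 2 ![0, x]) {0}ᶜ →
    AxisConeKL (fun x => S 2 ![0, x]) → DiagConeKL (fun x => S 2 ![0, x]) →
    ∀ (R : EuclideanSpace ℝ (Fin 3) ≃ₗᵢ[ℝ] EuclideanSpace ℝ (Fin 3)) (x : EuclideanSpace ℝ (Fin 3)),
      S 2 ![0, R x] = S 2 ![0, x]

/-- `LightConeRoundnessWithoutMirrors` is weaker than `LightConeRoundnessWithoutIsingLimit` (more hypotheses). -/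
theorem withoutMirrors_of_withoutIsingLimit (h : LightConeRoundnessWithoutIsingLimit) :
    LightConeRoundnessWithoutMirrors :=
  fun Δ S _ _ hnorm hnd htr hsc _ hax hdg => h Δ S hnorm hnd htr hsc hax hdg

/-- The ellipsoidal quadratic form `Q(x) = 2x₀² + 2x₀x₁ + 2x₁² + 3x₂² = 3x_d² + x_{d'}² + 3x₂²`
(`d = (e₀+e₁)/√2`, `d' = (e₀-e₁)/√2`): transverse stiffness `≼` the time coefficient `3` in BOTH frames `e₂`
and `d`, which is exactly the unit-cone condition after a linear change of the transverse momentum. -/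
noncomputable def ellQ (x : EuclideanSpace ℝ (Fin 3)) : ℝ :=
  2 * x 0 ^ 2 + 2 * (x 0 * x 1) + 2 * x 1 ^ 2 + 3 * x 2 ^ 2

/-- The ellipsoid kernel `Q(x)^(-Δ)` (value `0` at the origin by `Real.zero_rpow`). -/
noncomputable def ellKernel (Δ : ℝ) (x : EuclideanSpace ℝ (Fin 3)) : ℝ :=
  ellQ x ^ (-Δ)

/-- The ellipsoid family: `S 2 (y, z) = Q(z - y)^(-Δ)`, all other `S n = 0`. -/
noncomputable def ellFamily (Δ : ℝ) : CorrFamily 3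
  | 2 => fun z => ellKernel Δ (z 1 - z 0)
  | _ => fun _ => 0

/-- The two-point entry of the ellipsoid family. -/
@[simp] theorem ellFamily_two (Δ : ℝ) (z : Fin 2 → EuclideanSpace ℝ (Fin 3)) :
    ellFamily Δ 2 z = ellKernel Δ (z 1 - z 0) := rfl

/-- Every entry of the ellipsoid family other than the two-point one vanishes. -/
theorem ellFamily_ne_two (Δ : ℝ) {n : ℕ} (hn : n ≠ 2) (z : Fin n → EuclideanSpace ℝ (Fin 3)) :
    ellFamily Δ n z = 0 := by
  match n, hn with
  | 0, _ => rfl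
  | 1, _ => rfl
  | 2, h => exact absurd rfl h
  | _ + 3, _ => rfl

/-- `Q` as a sum of squares. -/
theorem ellQ_eq (x : EuclideanSpace ℝ (Fin 3)) :
    ellQ x = x 0 ^ 2 + x 1 ^ 2 + (x 0 + x 1) ^ 2 + 3 * x 2 ^ 2 := by
  unfold ellQ; ring

/-- `Q ≥ 0`. -/
theorem ellQ_nonneg (x : EuclideanSpace ℝ (Fin 3)) : 0 ≤ ellQ x := by
  rw [ellQ_eq]; positivity

/-- `Q(0) = 0`. -/
theorem ellQ_zero : ellQ 0 = 0 := by simp [ellQ]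

/-- `Q > 0` off the origin (positive definiteness). -/
theorem ellQ_pos {x : EuclideanSpace ℝ (Fin 3)} (hx : x ≠ 0) : 0 < ellQ x := by
  rcases (ellQ_nonneg x).lt_or_eq with h | h
  · exact h
  · exfalso
    apply hx
    have hsum : x 0 ^ 2 + x 1 ^ 2 + (x 0 + x 1) ^ 2 + 3 * x 2 ^ 2 = 0 := by rw [← ellQ_eq]; exact h.symm
    have h0 : x 0 ^ 2 = 0 := by
      nlinarith [sq_nonneg (x 0), sq_nonneg (x 1), sq_nonneg (x 0 + x 1), sq_nonneg (x 2)]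
    have h1 : x 1 ^ 2 = 0 := by
      nlinarith [sq_nonneg (x 0), sq_nonneg (x 1), sq_nonneg (x 0 + x 1), sq_nonneg (x 2)]
    have h2 : x 2 ^ 2 = 0 := by
      nlinarith [sq_nonneg (x 0), sq_nonneg (x 1), sq_nonneg (x 0 + x 1), sq_nonneg (x 2)]
    have h0' : x 0 = 0 := (pow_eq_zero_iff two_ne_zero).mp h0
    have h1' : x 1 = 0 := (pow_eq_zero_iff two_ne_zero).mp h1
    have h2' : x 2 = 0 := (pow_eq_zero_iff two_ne_zero).mp h2
    ext i
    fin_cases i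
    · simpa using h0'
    · simpa using h1'
    · simpa using h2'

/-- `Q` is a quadratic form: `Q(c x) = c² Q(x)`. -/
theorem ellQ_smul (c : ℝ) (x : EuclideanSpace ℝ (Fin 3)) : ellQ (c • x) = c ^ 2 * ellQ x := by
  simp only [ellQ, PiLp.smul_apply, smul_eq_mul]; ring

/-- `Q` is continuous. -/
theorem continuous_ellQ : Continuous ellQ := by
  have h : ∀ i : Fin 3, Continuous fun x : EuclideanSpace ℝ (Fin 3) => x i :=
    fun i => PiLp.continuous_apply 2 _ i
  unfold ellQ
  exact (((continuous_const.mul ((h 0).pow 2)).add (continuous_const.mul ((h 0).mul (h 1)))).add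
    (continuous_const.mul ((h 1).pow 2))).add (continuous_const.mul ((h 2).pow 2))

/-- The ellipsoid kernel vanishes at the origin (`Δ ≠ 0`). -/
theorem ellKernel_zero {Δ : ℝ} (hΔ : Δ ≠ 0) : ellKernel Δ 0 = 0 := by
  rw [ellKernel, ellQ_zero, Real.zero_rpow (neg_ne_zero.mpr hΔ)]

/-- The ellipsoid kernel is positive off the origin. -/
theorem ellKernel_pos (Δ : ℝ) {x : EuclideanSpace ℝ (Fin 3)} (hx : x ≠ 0) : 0 < ellKernel Δ x :=
  Real.rpow_pos_of_pos (ellQ_pos hx) _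

/-- The ellipsoid kernel is homogeneous of degree `-2Δ`. -/
theorem ellKernel_smul (Δ : ℝ) {c : ℝ} (hc : 0 < c) (x : EuclideanSpace ℝ (Fin 3)) :
    ellKernel Δ (c • x) = c ^ (-(2:ℝ) * Δ) * ellKernel Δ x := by
  unfold ellKernel
  rw [ellQ_smul, Real.mul_rpow (sq_nonneg c) (ellQ_nonneg x)]
  congr 1
  rw [show -(2:ℝ) * Δ = 2 * (-Δ) by ring, Real.rpow_mul hc.le, Real.rpow_two]

/-- The ellipsoid kernel is continuous off the origin. -/
theorem continuousOn_ellKernel (Δ : ℝ) : ContinuousOn (ellKernel Δ) {0}ᶜ :=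
  continuous_ellQ.continuousOn.rpow_const fun _x hx => Or.inl (ellQ_pos hx).ne'

/-- H3 for the ellipsoid family (`Δ ≠ 0`). -/
theorem ellFamily_normalised {Δ : ℝ} (hΔ : Δ ≠ 0) : ∀ n z, z ∉ NonCoincident 3 n → ellFamily Δ n z = 0 := by
  intro n z hz
  by_cases hn : n = 2
  · subst hn
    rw [ellFamily_two]
    have h10 : z 1 - z 0 = 0 := by
      rw [mem_nonCoincident, Function.Injective] at hz
      push Not at hz
      obtain ⟨i, j, hij, hne⟩ := hz
      fin_cases i <;> fin_cases j
      · exact absurd rfl hne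
      · simpa [sub_eq_zero] using hij.symm
      · simpa [sub_eq_zero] using hij
      · exact absurd rfl hne
    rw [h10, ellKernel_zero hΔ]
  · exact ellFamily_ne_two Δ hn z

/-- H4 for the ellipsoid family. -/
theorem ellFamily_nondegenerate (Δ : ℝ) : IsNondegenerateTwoPoint (ellFamily Δ) := by
  intro z hz
  rw [mem_nonCoincident] at hz
  rw [ellFamily_two]
  refine ellKernel_pos Δ fun h => ?_
  have h10 : z 1 = z 0 := sub_eq_zero.mp h
  exact absurd (hz h10) (by decide)

/-- H5 for the ellipsoid family. -/
theorem ellFamily_translationInvariant (Δ : ℝ) : IsTranslationInvariant (ellFamily Δ) := by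
  intro n v z
  by_cases hn : n = 2
  · subst hn
    simp only [ellFamily_two, add_sub_add_right_eq_sub]
  · simp [ellFamily_ne_two Δ hn]

/-- H6 for the ellipsoid family: scale covariance with dimension `Δ`. -/
theorem ellFamily_scaleCovariant (Δ : ℝ) : IsScaleCovariant Δ (ellFamily Δ) := by
  intro n c hc z
  by_cases hn : n = 2
  · subst hn
    simp only [ellFamily_two, Nat.cast_ofNat]
    rw [← smul_sub, ellKernel_smul Δ hc]
  · simp [ellFamily_ne_two Δ hn]

/-- Continuity off `0` of the ellipsoid family's two-point kernel (= `ellKernel Δ`). -/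
theorem ellFamily_continuousOn (Δ : ℝ) :
    ContinuousOn (fun x : EuclideanSpace ℝ (Fin 3) => ellFamily Δ 2 ![0, x]) {0}ᶜ := by
  rw [show (fun x : EuclideanSpace ℝ (Fin 3) => ellFamily Δ 2 ![0, x]) = ellKernel Δ from funext fun x => by simp]
  exact continuousOn_ellKernel Δ

/-- The spacelike region `{ω < ‖k‖}` is measurable. -/
theorem measurableSet_spacelike :
    MeasurableSet {p : EuclideanSpace ℝ (Fin 2) × ℝ | p.2 < ‖p.1‖} :=
  measurableSet_lt continuous_snd.measurable continuous_fst.norm.measurable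

/-- Continuity of the transverse-momentum coordinates. -/
theorem continuous_momentum (i : Fin 2) : Continuous fun p : EuclideanSpace ℝ (Fin 2) × ℝ => p.1 i :=
  (PiLp.continuous_apply 2 _ i).comp continuous_fst

/-- Continuity of the Källén–Lehmann integrand. -/
theorem continuous_klIntegrand (a b t : ℝ) :
    Continuous fun p : EuclideanSpace ℝ (Fin 2) × ℝ => Real.cos (p.1 0 * a + p.1 1 * b) * Real.exp (-(p.2 * |t|)) :=
  (Real.continuous_cos.comp (((continuous_momentum 0).mul continuous_const).add
    ((continuous_momentum 1).mul continuous_const))).mul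
    (Real.continuous_exp.comp ((continuous_snd.mul continuous_const).neg))

/-- The transverse-momentum change of variables for the axis frame `e₂`:
`k ↦ (k₀/√2 + k₁/√6, k₀/√2 - k₁/√6)`, `ω ↦ ω` (operator norm `1`). -/
noncomputable def axisMap (p : EuclideanSpace ℝ (Fin 2) × ℝ) : EuclideanSpace ℝ (Fin 2) × ℝ :=
  ((p.1 0 * (Real.sqrt 2)⁻¹ + p.1 1 * (Real.sqrt 6)⁻¹) • EuclideanSpace.single 0 (1:ℝ) +
    (p.1 0 * (Real.sqrt 2)⁻¹ - p.1 1 * (Real.sqrt 6)⁻¹) • EuclideanSpace.single 1 (1:ℝ), p.2)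

/-- The transverse-momentum change of variables for the diagonal frame: `k ↦ (k₀/√3, k₁)`, `ω ↦ ω`. -/
noncomputable def diagMap (p : EuclideanSpace ℝ (Fin 2) × ℝ) : EuclideanSpace ℝ (Fin 2) × ℝ :=
  ((p.1 0 * (Real.sqrt 3)⁻¹) • EuclideanSpace.single 0 (1:ℝ) + p.1 1 • EuclideanSpace.single 1 (1:ℝ), p.2)

/-- First new momentum coordinate under `axisMap`. -/
@[simp] theorem axisMap_fst_zero (p : EuclideanSpace ℝ (Fin 2) × ℝ) :
    (axisMap p).1 0 = p.1 0 * (Real.sqrt 2)⁻¹ + p.1 1 * (Real.sqrt 6)⁻¹ := by simp [axisMap]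

/-- Second new momentum coordinate under `axisMap`. -/
@[simp] theorem axisMap_fst_one (p : EuclideanSpace ℝ (Fin 2) × ℝ) :
    (axisMap p).1 1 = p.1 0 * (Real.sqrt 2)⁻¹ - p.1 1 * (Real.sqrt 6)⁻¹ := by simp [axisMap]

/-- `axisMap` fixes the energy `ω`. -/
@[simp] theorem axisMap_snd (p : EuclideanSpace ℝ (Fin 2) × ℝ) : (axisMap p).2 = p.2 := rfl

/-- First new momentum coordinate under `diagMap`. -/
@[simp] theorem diagMap_fst_zero (p : EuclideanSpace ℝ (Fin 2) × ℝ) :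
    (diagMap p).1 0 = p.1 0 * (Real.sqrt 3)⁻¹ := by simp [diagMap]

/-- Second new momentum coordinate under `diagMap`. -/
@[simp] theorem diagMap_fst_one (p : EuclideanSpace ℝ (Fin 2) × ℝ) : (diagMap p).1 1 = p.1 1 := by simp [diagMap]

/-- `diagMap` fixes the energy `ω`. -/
@[simp] theorem diagMap_snd (p : EuclideanSpace ℝ (Fin 2) × ℝ) : (diagMap p).2 = p.2 := rfl

/-- `axisMap` is continuous. -/
theorem continuous_axisMap : Continuous axisMap := by
  unfold axisMap
  refine Continuous.prodMk ?_ continuous_snd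
  exact ((((continuous_momentum 0).mul continuous_const).add
    ((continuous_momentum 1).mul continuous_const)).smul continuous_const).add
    ((((continuous_momentum 0).mul continuous_const).sub
      ((continuous_momentum 1).mul continuous_const)).smul continuous_const)

/-- `diagMap` is continuous. -/
theorem continuous_diagMap : Continuous diagMap := by
  unfold diagMap
  refine Continuous.prodMk ?_ continuous_snd
  exact (((continuous_momentum 0).mul continuous_const).smul continuous_const).add
    ((continuous_momentum 1).smul continuous_const)

/-- `(1/√n)² = 1/n` for `0 ≤ n`. -/
theorem inv_sqrt_sq {n : ℝ} (hn : 0 ≤ n) : ((Real.sqrt n)⁻¹) ^ 2 = n⁻¹ := by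
  rw [inv_pow, Real.sq_sqrt hn]

/-- `axisMap` does not increase the transverse momentum: `‖k'‖² = k₀² + k₁²/3 ≤ ‖k‖²`. -/
theorem norm_axisMap_le (p : EuclideanSpace ℝ (Fin 2) × ℝ) : ‖(axisMap p).1‖ ≤ ‖p.1‖ := by
  rw [EuclideanSpace.norm_eq, EuclideanSpace.norm_eq]
  apply Real.sqrt_le_sqrt
  simp only [Fin.sum_univ_two, Real.norm_eq_abs, sq_abs, axisMap_fst_zero, axisMap_fst_one]
  have e : (p.1 0 * (Real.sqrt 2)⁻¹ + p.1 1 * (Real.sqrt 6)⁻¹) ^ 2 +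
      (p.1 0 * (Real.sqrt 2)⁻¹ - p.1 1 * (Real.sqrt 6)⁻¹) ^ 2 =
      2 * p.1 0 ^ 2 * ((Real.sqrt 2)⁻¹) ^ 2 + 2 * p.1 1 ^ 2 * ((Real.sqrt 6)⁻¹) ^ 2 := by ring
  rw [e, inv_sqrt_sq (by norm_num : (0:ℝ) ≤ 2), inv_sqrt_sq (by norm_num : (0:ℝ) ≤ 6)]
  nlinarith [sq_nonneg (p.1 1)]

/-- `diagMap` does not increase the transverse momentum: `‖k'‖² = k₀²/3 + k₁² ≤ ‖k‖²`. -/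
theorem norm_diagMap_le (p : EuclideanSpace ℝ (Fin 2) × ℝ) : ‖(diagMap p).1‖ ≤ ‖p.1‖ := by
  rw [EuclideanSpace.norm_eq, EuclideanSpace.norm_eq]
  apply Real.sqrt_le_sqrt
  simp only [Fin.sum_univ_two, Real.norm_eq_abs, sq_abs, diagMap_fst_zero, diagMap_fst_one]
  rw [mul_pow, inv_sqrt_sq (by norm_num : (0:ℝ) ≤ 3)]
  nlinarith [sq_nonneg (p.1 0)]

/-- Push-forward of a cone-supported measure under a momentum-contracting map is cone-supported. -/
theorem cone_of_map {μ : Measure (EuclideanSpace ℝ (Fin 2) × ℝ)}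
    (hμ : μ {p : EuclideanSpace ℝ (Fin 2) × ℝ | p.2 < ‖p.1‖} = 0)
    {φ : EuclideanSpace ℝ (Fin 2) × ℝ → EuclideanSpace ℝ (Fin 2) × ℝ} (hφ : Continuous φ)
    (hnorm : ∀ p, ‖(φ p).1‖ ≤ ‖p.1‖) (hsnd : ∀ p, (φ p).2 = p.2) (r : ENNReal) :
    (Measure.map φ (r • μ)) {p : EuclideanSpace ℝ (Fin 2) × ℝ | p.2 < ‖p.1‖} = 0 := by
  rw [Measure.map_apply hφ.measurable measurableSet_spacelike]
  have hsub : φ ⁻¹' {p : EuclideanSpace ℝ (Fin 2) × ℝ | p.2 < ‖p.1‖} ⊆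
      {p : EuclideanSpace ℝ (Fin 2) × ℝ | p.2 < ‖p.1‖} := fun p hp => by
    simp only [Set.mem_preimage, Set.mem_setOf_eq, hsnd] at hp
    exact lt_of_lt_of_le hp (hnorm p)
  refine measure_mono_null hsub ?_
  rw [Measure.smul_apply, hμ, smul_zero]

/-- Change of variables in the Källén–Lehmann integral. -/
theorem integral_map_smul {μ : Measure (EuclideanSpace ℝ (Fin 2) × ℝ)}
    {φ : EuclideanSpace ℝ (Fin 2) × ℝ → EuclideanSpace ℝ (Fin 2) × ℝ} (hφ : Continuous φ)
    {r : ℝ} (hr : 0 ≤ r) (a b t : ℝ) :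
    ∫ p, Real.cos (p.1 0 * a + p.1 1 * b) * Real.exp (-(p.2 * |t|)) ∂(Measure.map φ (ENNReal.ofReal r • μ)) =
      r * ∫ p, Real.cos ((φ p).1 0 * a + (φ p).1 1 * b) * Real.exp (-((φ p).2 * |t|)) ∂μ := by
  rw [integral_map hφ.measurable.aemeasurable (continuous_klIntegrand a b t).aestronglyMeasurable,
    integral_smul_measure, ENNReal.toReal_ofReal hr, smul_eq_mul]

/-- Value of `Q` at a point of the axis frame `e₂`. -/
theorem ellQ_axisPoint (a b t : ℝ) :
    ellQ (EuclideanSpace.single 0 a + EuclideanSpace.single 1 b + EuclideanSpace.single 2 t) =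
      2 * a ^ 2 + 2 * (a * b) + 2 * b ^ 2 + 3 * t ^ 2 := by
  simp [ellQ]

/-- Value of `Q` at a point of the diagonal frame. -/
theorem ellQ_diagPoint (t u v : ℝ) :
    ellQ (EuclideanSpace.single 0 ((t + u) / Real.sqrt 2) + EuclideanSpace.single 1 ((t - u) / Real.sqrt 2) +
      EuclideanSpace.single 2 v) = 3 * t ^ 2 + u ^ 2 + 3 * v ^ 2 := by
  simp only [ellQ_axisPoint, div_eq_mul_inv]
  have e : 2 * ((t + u) * (Real.sqrt 2)⁻¹) ^ 2 + 2 * ((t + u) * (Real.sqrt 2)⁻¹ * ((t - u) * (Real.sqrt 2)⁻¹)) +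
      2 * ((t - u) * (Real.sqrt 2)⁻¹) ^ 2 = (6 * t ^ 2 + 2 * u ^ 2) * ((Real.sqrt 2)⁻¹) ^ 2 := by ring
  rw [e, inv_sqrt_sq (by norm_num : (0:ℝ) ≤ 2)]; ring

/-- H7 for the ellipsoid family, from the round kernel's axis-frame representation: push the round measure
(scaled by `3^(-Δ)`) forward under `axisMap`. -/
theorem ellFamily_axisConeKL {Δ : ℝ} (hKL : RoundKernelAxisConeKL Δ) :
    AxisConeKL (fun x => ellFamily Δ 2 ![0, x]) := by
  obtain ⟨μ₀, hμ₀, hrep⟩ := hKL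
  refine ⟨Measure.map axisMap (ENNReal.ofReal ((3:ℝ) ^ (-Δ)) • μ₀),
    cone_of_map hμ₀ continuous_axisMap norm_axisMap_le axisMap_snd _, fun t a b ht => ?_⟩
  rw [integral_map_smul continuous_axisMap (Real.rpow_nonneg (by norm_num) _)]
  have hfun : (fun p : EuclideanSpace ℝ (Fin 2) × ℝ =>
      Real.cos ((axisMap p).1 0 * a + (axisMap p).1 1 * b) * Real.exp (-((axisMap p).2 * |t|))) =
      fun p => Real.cos (p.1 0 * ((Real.sqrt 2)⁻¹ * (a + b)) + p.1 1 * ((Real.sqrt 6)⁻¹ * (a - b))) *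
        Real.exp (-(p.2 * |t|)) := by
    funext p
    rw [axisMap_fst_zero, axisMap_fst_one, axisMap_snd]
    congr 2
    ring
  rw [hfun, ← hrep t _ _ ht]
  simp only [ellFamily_two, Matrix.cons_val_one, Matrix.cons_val_zero, sub_zero, ellKernel, ellQ_axisPoint]
  rw [← Real.mul_rpow (by norm_num) (by positivity)]
  congr 1
  rw [mul_pow, mul_pow, inv_sqrt_sq (by norm_num : (0:ℝ) ≤ 2), inv_sqrt_sq (by norm_num : (0:ℝ) ≤ 6)]
  ring

/-- H8 for the ellipsoid family, from the round kernel's axis-frame representation: push the round measure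
(scaled by `3^(-Δ)`) forward under `diagMap`. -/
theorem ellFamily_diagConeKL {Δ : ℝ} (hKL : RoundKernelAxisConeKL Δ) :
    DiagConeKL (fun x => ellFamily Δ 2 ![0, x]) := by
  obtain ⟨μ₀, hμ₀, hrep⟩ := hKL
  refine ⟨Measure.map diagMap (ENNReal.ofReal ((3:ℝ) ^ (-Δ)) • μ₀),
    cone_of_map hμ₀ continuous_diagMap norm_diagMap_le diagMap_snd _, fun t u v ht => ?_⟩
  rw [integral_map_smul continuous_diagMap (Real.rpow_nonneg (by norm_num) _)]
  have hfun : (fun p : EuclideanSpace ℝ (Fin 2) × ℝ =>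
      Real.cos ((diagMap p).1 0 * u + (diagMap p).1 1 * v) * Real.exp (-((diagMap p).2 * |t|))) =
      fun p => Real.cos (p.1 0 * ((Real.sqrt 3)⁻¹ * u) + p.1 1 * v) * Real.exp (-(p.2 * |t|)) := by
    funext p
    rw [diagMap_fst_zero, diagMap_fst_one, diagMap_snd]
    congr 2
    ring
  rw [hfun, ← hrep t _ _ ht]
  simp only [ellFamily_two, Matrix.cons_val_one, Matrix.cons_val_zero, sub_zero, ellKernel, ellQ_diagPoint]
  rw [← Real.mul_rpow (by norm_num) (by positivity)]
  congr 1
  rw [mul_pow, inv_sqrt_sq (by norm_num : (0:ℝ) ≤ 3)]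
  ring

/-- **The lattice mirror symmetries are load-bearing** (conditional on the classical representation
`RoundKernelAxisConeKL Δ₀` of the round kernel at one exponent `Δ₀ ∈ [1/2, 1]`): the ellipsoid family at `Δ₀`
satisfies the window, H3–H6, continuity off `0` and BOTH unit-cone representations H7, H8, and its kernel takes
the values `2^(-Δ₀) ≠ 3^(-Δ₀)` at `e₀` and `e₂ = swap₀₂ e₀`. -/
theorem lightConeRoundness_false_without_mirrors_of_roundKL {Δ₀ : ℝ} (h₁ : 1 / 2 ≤ Δ₀) (h₂ : Δ₀ ≤ 1)
    (hKL : RoundKernelAxisConeKL Δ₀) : ¬ LightConeRoundnessWithoutMirrors := by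
  intro h
  have hΔ0 : Δ₀ ≠ 0 := by intro h0; rw [h0] at h₁; norm_num at h₁
  have key := h Δ₀ (ellFamily Δ₀) h₁ h₂ (ellFamily_normalised hΔ0) (ellFamily_nondegenerate Δ₀)
    (ellFamily_translationInvariant Δ₀) (ellFamily_scaleCovariant Δ₀) (ellFamily_continuousOn Δ₀)
    (ellFamily_axisConeKL hKL) (ellFamily_diagConeKL hKL)
    (LinearIsometryEquiv.piLpCongrLeft 2 ℝ ℝ (Equiv.swap (0 : Fin 3) 2)) (EuclideanSpace.single 0 1)
  simp only [ellFamily_two, Matrix.cons_val_one, Matrix.cons_val_zero, sub_zero,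
    LinearIsometryEquiv.piLpCongrLeft_single, Equiv.swap_apply_left, ellKernel] at key
  have hQ2 : ellQ (EuclideanSpace.single 2 (1:ℝ)) = 3 := by simp [ellQ]
  have hQ0 : ellQ (EuclideanSpace.single 0 (1:ℝ)) = 2 := by simp [ellQ]
  rw [hQ2, hQ0] at key
  have hlt : (3:ℝ) ^ (-Δ₀) < 2 ^ (-Δ₀) :=
    Real.rpow_lt_rpow_of_neg (by norm_num) (by norm_num) (by linarith)
  exact hlt.ne key

end Summit.CriticalPhenomena.Ising3DConformalLimit.Cruxes.LightConeRoundness.Disproof
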